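import Summits.Ventures.WeilGRH.MinorantZetaTransferOdd
import Literature.NumberTheory.LFunctions.WeilGroundStateRealZerosProofs
import HarnessLib

/-!
# GRH arm (rh-explicit, venture WeilGRH): the `ζ`-transfer floor laws with `ζ`'s GROUND ENERGY as the parameter —
  `log q ≥ 2(sinh t + t) − ε(t)` suffices, at EVERY window, with no positivity hypothesis

Cell `rh-explicit`, WEIL TRACK — GRH ARM (weil-grh-2 gen6; sequel of `MinorantZetaTransfer.lean` /
`MinorantZetaTransferOdd.lean`).  The laws there assume `WeilPositivityOn t` (`⇔ ε(t) ≥ 0`,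
`weilGroundEnergy_nonneg_iff_holds`).  Since `ε(t)‖g‖₂² ≤ Re Q_ζ(g)` for every test function on `[-t, t]`
(`ConnesVanSuijlekom.weilGroundEnergy_mul_le_re`: the definition of the ground energy `ε(t) = weilGroundEnergy t`
as an infimum), the same two-line argument gives, for EVERY `t > 0` and with NO hypothesis on `ζ`:

* `weilPositivityOnChar_of_groundEnergy`: `2(sinh t + t) − ε(t) ≤ log q` ⇒ `WeilPositivityOnChar χ t` for every
  Dirichlet character `χ` mod `q ≠ 1`;
* `weilPositivityOnChar_odd_of_groundEnergy`: `2(sinh t + t + 2γt + γ² tanh(t/2)) ≤ (1 − γ²)(log q + ε(t))`, `γ² < 1`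
  ⇒ the same for every ODD `χ`.

So the uniform conductor floor of the arm at ANY window is bounded by a closed form plus ONE real number of the lead
track, `log q₀(t) ≤ 2(sinh t + t) − ε(t)`: every certified lower bound for `ζ`'s ground energy at `t = 1` — positive
(W-M4) or not — is a uniform `t = 1` floor for every Dirichlet character, and a certified `ε(t) > 0` LOWERS the floor
below `⌈e^{2(sinh t + t)}⌉`.  Honest scope: nothing here bounds `ε(t)`; nothing is a step towards RH or GRH.
Everything is PROVED; no definitions, no named facts; standard axioms.

## References

* E. Bombieri (2000), §4 Problem 2 (the ground energy) [Bombieri2000Weil]; A. Weil (1952), (11) and the «lemme»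
  p. 262 [Weil1952FormulesExplicites]; H. Yoshida (1992), §6 (6.2) [Yoshida1992].
-/

set_option autoImplicit false

noncomputable section

open Complex Set MeasureTheory
open scoped Real

namespace Summit.Ventures.WeilGRH

open Literature.NumberTheory.LFunctions

variable {q : ℕ} {g : ℝ → ℂ}

/-- **The even pseudo-key above `2(sinh t + t) − ε(t)` is non-negative on test functions** supported in `[-t, t]`:
`keyMarkovForm 0 L 1 t g = Re Q_ζ(g) − P(g) + L‖g‖₂² ≥ (ε(t) − 2(sinh t + t) + L)‖g‖₂²`.
[cite: Bombieri2000Weil, §4 Problem 2; Yoshida1992, §6 eq. (6.2)] -/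
theorem keyMarkovForm_allTrivial_zero_nonneg_of_groundEnergy {t L : ℝ}
    (hL : 2 * (Real.sinh t + t) - weilGroundEnergy t ≤ L) (hg : IsWeilTest g) (hsupp : tsupport g ⊆ Icc (-t) t) :
    0 ≤ keyMarkovForm 0 L (fun _ ↦ 1) t g := by
  rw [keyMarkovForm_allTrivial_zero_eq, weilWindowForm_eq_re_weilQuadratic hg hsupp]
  have h1 := ConnesVanSuijlekom.weilGroundEnergy_mul_le_re hg hsupp
  have h2 := weilPoleForm_le_of_tsupport_subset hg hsupp
  have h3 : 0 ≤ ∫ x : ℝ, ‖g x‖ ^ 2 := integral_nonneg fun _ ↦ by positivity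
  have h4 := mul_le_mul_of_nonneg_right hL h3
  nlinarith

/-- ★★ **The floor law with `ζ`'s ground energy** (no positivity hypothesis): for `t > 0` and every Dirichlet
character `χ` mod `q ≠ 1` with `2(sinh t + t) − ε(t) ≤ log q`, `WeilPositivityOnChar χ t`.
[cite: Bombieri2000Weil, §4 Problem 2; Weil1952FormulesExplicites, the «lemme» p. 262] -/
theorem weilPositivityOnChar_of_groundEnergy {t : ℝ} (ht : 0 < t) (hq : q ≠ 1) (χ : DirichletCharacter ℂ q)
    (hL : 2 * (Real.sinh t + t) - weilGroundEnergy t ≤ Real.log q) : WeilPositivityOnChar χ t := by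
  have hN : Real.exp (2 * t) ≤ ((⌊Real.exp (2 * t)⌋₊ : ℕ) : ℝ) + 1 := (Nat.lt_floor_add_one _).le
  exact weilPositivityOnChar_of_allTrivial_even_key_nonneg ht hN
    (fun g hg hsupp ↦ by
      rw [← keyMarkovForm_eq_weilFinitePrimeQuadraticKey hg hsupp hN (a := 0) (Nat.zero_le _)]
      exact keyMarkovForm_allTrivial_zero_nonneg_of_groundEnergy le_rfl hg hsupp)
    hq χ hL

/-- **The odd pseudo-key with the ground energy**: `2E(t, γ) ≤ (1 − γ²)(L + ε(t))`, `γ² < 1` ⇒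
`0 ≤ keyMarkovForm 1 L 1 t g` for test `g` on `[-t, t]` (`t ≥ 0`). [cite: Bombieri2000Weil, §4 Problem 2] -/
theorem keyMarkovForm_allTrivial_one_nonneg_of_groundEnergy {t : ℝ} (ht : 0 ≤ t) {γ : ℝ} (hγ : γ ^ 2 < 1) {L : ℝ}
    (hL : 2 * (Real.sinh t + t + 2 * γ * t + γ ^ 2 * Real.tanh (t / 2)) ≤ (1 - γ ^ 2) * (L + weilGroundEnergy t))
    (hg : IsWeilTest g) (hsupp : tsupport g ⊆ Icc (-t) t) :
    0 ≤ keyMarkovForm 1 L (fun _ ↦ 1) t g := by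
  rw [keyMarkovForm_one_eq_zero_add_sech hg hsupp, keyMarkovForm_allTrivial_zero_eq,
    weilWindowForm_eq_re_weilQuadratic hg hsupp]
  set x : ℂ := ∫ u : ℝ, g u * (Real.cosh (u / 2) : ℂ) with hx
  set s : ℂ := ∫ u : ℝ, g u * (Real.sinh (u / 2) : ℂ) with hs
  set Y : ℂ := ∫ u : ℝ, g u / (2 * Real.cosh (u / 2) : ℂ) with hY
  set S : ℝ := 1 / (2 * π) * ∫ τ : ℝ, ‖weilMellin g (1 / 2 + τ * I)‖ ^ 2 * (π / Real.cosh (π * τ)) with hS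
  set Ng : ℝ := ∫ u : ℝ, ‖g u‖ ^ 2 with hNg
  set E : ℝ := Real.sinh t + t + 2 * γ * t + γ ^ 2 * Real.tanh (t / 2) with hE
  have hP : weilPoleForm g = 2 * ‖x‖ ^ 2 - 2 * ‖s‖ ^ 2 := rfl
  have h1 := ConnesVanSuijlekom.weilGroundEnergy_mul_le_re hg hsupp
  have hSY : 2 * ‖Y‖ ^ 2 ≤ S := two_mul_norm_sq_sech_pairing_le hg
  have hNg0 : 0 ≤ Ng := integral_nonneg fun _ ↦ by positivity
  have hγ' : 0 < 1 - γ ^ 2 := by linarith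
  have hprof : Continuous fun u : ℝ ↦ Real.cosh (u / 2) + γ / (2 * Real.cosh (u / 2)) :=
    Continuous.add (by fun_prop) (Continuous.div continuous_const (by fun_prop) fun u ↦ by positivity)
  have hCS : ‖x + (γ : ℂ) * Y‖ ^ 2 ≤ E * Ng := by
    rw [hx, hY, integral_mul_cosh_add_mul_integral_sech hg γ, hE, ← integral_Icc_cosh_add_sech_sq ht γ]
    exact norm_sq_integral_mul_real_le hg ht hsupp hprof
  have hid := norm_sq_add_mul_sub x Y γ
  have hkey : (1 - γ ^ 2) * (‖x‖ ^ 2 - ‖Y‖ ^ 2) ≤ E * Ng := by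
    rw [← hid]
    linarith [sq_nonneg ‖(γ : ℂ) * x + Y‖]
  have hL' : 2 * E * Ng ≤ (1 - γ ^ 2) * (L + weilGroundEnergy t) * Ng := by
    have := mul_le_mul_of_nonneg_right hL hNg0
    linarith
  have h2 : (1 - γ ^ 2) * (2 * (‖x‖ ^ 2 - ‖Y‖ ^ 2)) ≤ (1 - γ ^ 2) * ((L + weilGroundEnergy t) * Ng) := by nlinarith
  have h3 : 2 * (‖x‖ ^ 2 - ‖Y‖ ^ 2) ≤ (L + weilGroundEnergy t) * Ng := le_of_mul_le_mul_left h2 hγ'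
  rw [hP]
  nlinarith [sq_nonneg ‖s‖]

/-- ★★ **The odd floor law with `ζ`'s ground energy**: `t > 0`, `γ² < 1`, `χ` mod `q ≠ 1` odd,
`2(sinh t + t + 2γt + γ² tanh(t/2)) ≤ (1 − γ²)(log q + ε(t))` ⇒ `WeilPositivityOnChar χ t`.
[cite: Bombieri2000Weil, §4 Problem 2; Weil1952FormulesExplicites, (10)–(11) pp. 258–262] -/
theorem weilPositivityOnChar_odd_of_groundEnergy {t : ℝ} (ht : 0 < t) {γ : ℝ} (hγ : γ ^ 2 < 1) (hq : q ≠ 1)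
    (χ : DirichletCharacter ℂ q) (hodd : charParity χ = 1)
    (hL : 2 * (Real.sinh t + t + 2 * γ * t + γ ^ 2 * Real.tanh (t / 2)) ≤
      (1 - γ ^ 2) * (Real.log q + weilGroundEnergy t)) :
    WeilPositivityOnChar χ t :=
  weilPositivityOnChar_of_allTrivial_test_nonneg ht
    (fun _ hg hsupp ↦ keyMarkovForm_allTrivial_one_nonneg_of_groundEnergy ht.le hγ hL hg hsupp) hq χ hodd le_rfl

/-- **The `t = 1` dividend of ANY certified lower bound for `ζ`'s ground energy**: if `−δ ≤ ε(1)` then every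
Dirichlet character `χ` mod `q ≠ 1` with `2(sinh 1 + 1) + δ ≤ log q` satisfies `WeilPositivityOnChar χ 1`
(`2(sinh 1 + 1) = 4.3504…`; `δ = 0` is W-M4 ⇒ `q ≥ 78`). [folklore] -/
theorem weilPositivityOnChar_one_of_groundEnergy_ge {δ : ℝ} (hδ : -δ ≤ weilGroundEnergy 1) (hq : q ≠ 1)
    (χ : DirichletCharacter ℂ q) (hL : 2 * (Real.sinh 1 + 1) + δ ≤ Real.log q) : WeilPositivityOnChar χ 1 :=
  weilPositivityOnChar_of_groundEnergy one_pos hq χ (by linarith)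

end Summit.Ventures.WeilGRH

end
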